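import Summits.ValiantsHypothesis.ValiantsHypothesis.Theorems.KPlusLogSqLawTropicalBComparabilitySum

/-!
# `TropicalB` (stmt-ValiantsHypothesis-19771) — the THREE-LINK COMPARABILITY LAW: a chain of three registers coupled
# only through two order constraints `y < a`, `b < p` carries at most `(N + U + 1)·L₁(⌊log₂L₁⌋+1)·L₂(⌊log₂L₂⌋+1)`
# dominant terms (cubic in the number of register points, against the quartic slope count)

Helper file for the crux `Theses.KPlusLogSqLaw.TropicalB` (`--supports stmt-ValiantsHypothesis-19771 --as helper`), cell
`pub-symmetroid`, seat val-sym-trop-p2 (g5; lineage question R25(a) of HOME/val-sym-trop-p2/g4/PASS-THROUGH.md «three pivots: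
exponent 2 or 3?»).  HONEST FRAMING: a structure theorem about a SUB-FAMILY of the terms of an ARBITRARY design, in the tree's
vocabulary (`IsDominant`, `tropWeight`, `termSign`); it extends the COMPARABILITY-SUM LAW `ComparabilitySum.card_dominant_le`
(val-sym-trop-p2 g4, p476777; two registers, one constraint) to THREE registers and TWO constraints.  It proves nothing about
`TropicalB` in its window and bears on neither `WeakLifting`, `MatrixDescartes` (stmt-ValiantsHypothesis-18050) nor VP ≠ VNP.

## Statement (`card_dominant_le_three`, in the part-2 file `…TropicalBComparabilityChainLaw`; this part 1 has the exchange lemmas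
and the cross–cross count `cc_card_le`)
Inside any design `(d, v, ε)` of format `(m, K)` take terms `τ j y a b p u` (`j < N`; `y, a < L₁`; `b, p < L₂`; `u < U`) which,
whenever `y < a` and `b < p`, are present, pairwise distinct, and have weights
`tropWeight d v θ (τ j y a b p u) = θ·(s₁ j y + s₂ a b + s₃ p u) − (A j y + W a b + B p u)` for ARBITRARY integer tables:
three REGISTERS — an outer one indexed by `(j, y)`, a MIDDLE one indexed by its two positions `(a, b)`, an outer one `(p, u)` —
whose slopes and valuations ADD, the middle register being coupled to the first through `y < a` (window of length `L₁`) and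
to the third through `b < p` (window of length `L₂`).  THEN the number of such members that are dominant (each at some integer
slope, against ALL present terms of the design) is at most `(N + U + 1) · L₁(⌊log₂ L₁⌋+1) · L₂(⌊log₂ L₂⌋+1)`.

## Proof (Gusfield's halving on BOTH constraint axes; the cross–cross members are a triple direct sum)
Assign a member to the dyadic node of window 1 at which its interval `[y, a)` is first split and to the dyadic node of window 2
at which `(b, p]` is first split.  Members sharing both nodes are pairwise FULLY EXCHANGEABLE (each of the three single-register
swaps is a feasible competitor), so two of them dominant at slopes `θ < θ'` have every register slope weakly increasing and at
least one strictly increasing (`s1_lt_of_cc`, `s2_lt_of_cc`, `s3_lt_of_cc`): a monotone staircase in three rank statistics,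
`≤ N·a₁ + b₁·a₂ + U·b₂` members for half-windows `a₁ | b₁` and `a₂ | b₂` (`cc_card_le`).  Summing over the window-2 tree and then
over the window-1 tree gives the bound (part 2: `cross_card_le`, `window_card_le`, `card_dominant_le_three`).

## Why this family, and what the number means (located; numbers, not adjectives)
* THREE-PIVOT INTERVAL REGISTERS.  On an upper-Hessenberg support with the diagonal absent exactly at pivots `P₁ < P₂ < P₃`, wrap
  entries around each pivot and region classes on the subdiagonal (K = 5), the perfect matchings are EXACTLY the triples of
  interval cycles `[aᵢ, bᵢ] ∋ Pᵢ` with `b₁ < a₂`, `b₂ < a₃`; slope and valuation add over the cycles; the hypotheses hold with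
  `(j, y) = (a₁, b₁ − P₁)`, `(a, b) = (a₂ − P₁, b₂ − P₂)`, `(p, u) = (a₃ − P₂, b₃)`.  Slope counting allows `≍ N·L₁·L₂·U` members
  (`≍ M⁴` at the natural sizes `N ≍ L₁ ≍ L₂ ≍ U ≍ M/4`); this file gives `≍ M³ log² M`; the seat's exact numerics
  (HOME/val-sym-trop-p2/g5/THREE-PIVOTS.md: threshold-model optimal corner paths, realised instances, local search) find only
  `≍ 1.2 ×` the number of register points, i.e. QUADRATIC — the cubic bound here is not believed tight; the obstruction to a
  quadratic proof is located there (the middle register's dominance-rectangle hull edges form a CUBIC budget, `L(L−1)(L+4)/3` for the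
  diagonal order).  For two registers the tree now has the LINEAR law `ComparabilityLinear.card_dominant_le_linear` (val-sym-trop-p5
  g5): no logarithm at all.
* WHAT IT IS NOT.  Not a bound on designs (terms outside the family are not counted); not a statement about `K`.
-/

set_option linter.dupNamespace false
set_option autoImplicit false

namespace Summit.ValiantsHypothesis.ValiantsHypothesis.Theorems.KPlusLogSqLaw.ComparabilityChain

open Summit.ValiantsHypothesis.ValiantsHypothesis.Theorems.MatrixDescartes.Negative
open Summit.ValiantsHypothesis.ValiantsHypothesis.Theorems.KPlusLogSqLaw.ComparabilitySum (card_le_of_biMonotone)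
open Finset

section Family

variable {m K N L₁ L₂ U : ℕ}
  (d : Fin K → ℕ) (v ε : Fin m → Fin m → Fin K → ℤ)
  (τ : Fin N → Fin L₁ → Fin L₁ → Fin L₂ → Fin L₂ → Fin U → Equiv.Perm (Fin m) × (Fin m → Fin K))
  (s₁ : Fin N → Fin L₁ → ℤ) (s₂ : Fin L₁ → Fin L₂ → ℤ) (s₃ : Fin L₂ → Fin U → ℤ)
  (A : Fin N → Fin L₁ → ℤ) (W : Fin L₁ → Fin L₂ → ℤ) (B : Fin L₂ → Fin U → ℤ)
  (hinj : ∀ j y a b p u j' y' a' b' p' u', y < a → b < p → y' < a' → b' < p' →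
    τ j y a b p u = τ j' y' a' b' p' u' → j = j' ∧ y = y' ∧ a = a' ∧ b = b' ∧ p = p' ∧ u = u')
  (hpres : ∀ j y a b p u, y < a → b < p → termSign ε (τ j y a b p u) ≠ 0)
  (hw : ∀ j y a b p u (θ : ℤ), y < a → b < p →
    tropWeight d v θ (τ j y a b p u) = θ * (s₁ j y + s₂ a b + s₃ p u) - (A j y + W a b + B p u))

include hinj hpres hw in
/-- the basic comparison: a dominant member beats every other feasible member of the family (explicit weights). -/
theorem weight_lt {j j' : Fin N} {y y' a a' : Fin L₁} {b b' p p' : Fin L₂} {u u' : Fin U} {θ : ℤ}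
    (hya : y < a) (hbp : b < p) (hya' : y' < a') (hbp' : b' < p')
    (hdom : IsDominant d v ε θ (τ j y a b p u))
    (hne : ¬ (j = j' ∧ y = y' ∧ a = a' ∧ b = b' ∧ p = p' ∧ u = u')) :
    θ * (s₁ j' y' + s₂ a' b' + s₃ p' u') - (A j' y' + W a' b' + B p' u') <
      θ * (s₁ j y + s₂ a b + s₃ p u) - (A j y + W a b + B p u) := by
  have h := hdom.2 (τ j' y' a' b' p' u') ?_ (hpres j' y' a' b' p' u' hya' hbp')
  · rwa [hw j' y' a' b' p' u' θ hya' hbp', hw j y a b p u θ hya hbp] at h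
  · intro h
    obtain ⟨h1, h2, h3, h4, h5, h6⟩ := hinj _ _ _ _ _ _ _ _ _ _ _ _ hya' hbp' hya hbp h
    exact hne ⟨h1.symm, h2.symm, h3.symm, h4.symm, h5.symm, h6.symm⟩

include hinj hpres hw in
/-- two family members dominant at the SAME slope coincide. -/
theorem eq_of_theta_eq {j j' : Fin N} {y y' a a' : Fin L₁} {b b' p p' : Fin L₂} {u u' : Fin U} {θ : ℤ}
    (hya : y < a) (hbp : b < p) (hya' : y' < a') (hbp' : b' < p')
    (h1 : IsDominant d v ε θ (τ j y a b p u)) (h2 : IsDominant d v ε θ (τ j' y' a' b' p' u')) :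
    j = j' ∧ y = y' ∧ a = a' ∧ b = b' ∧ p = p' ∧ u = u' := by
  by_contra hne
  have hne' : ¬ (j' = j ∧ y' = y ∧ a' = a ∧ b' = b ∧ p' = p ∧ u' = u) := by
    rintro ⟨e1, e2, e3, e4, e5, e6⟩; exact hne ⟨e1.symm, e2.symm, e3.symm, e4.symm, e5.symm, e6.symm⟩
  have e1 := weight_lt d v ε τ s₁ s₂ s₃ A W B hinj hpres hw hya hbp hya' hbp' h1 hne
  have e2 := weight_lt d v ε τ s₁ s₂ s₃ A W B hinj hpres hw hya' hbp' hya hbp h2 hne'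
  linarith

/-! ### Cross–cross exchanges: members whose first interval crosses a cut `mid₁` of window 1 (`y < mid₁ ≤ a`) and whose
second interval crosses a cut `mid₂` of window 2 (`b < mid₂ ≤ p`) are fully exchangeable register by register. -/

include hinj hpres hw in
/-- FIRST register moves forward: `s₁ j y < s₁ j' y'` unless `(j, y) = (j', y')`. -/
theorem s1_lt_of_cc {j j' : Fin N} {y y' a a' : Fin L₁} {b b' p p' : Fin L₂} {u u' : Fin U} {θ θ' : ℤ} {mid₁ mid₂ : ℕ}
    (hy : (y : ℕ) < mid₁) (hy' : (y' : ℕ) < mid₁) (ha : mid₁ ≤ (a : ℕ)) (ha' : mid₁ ≤ (a' : ℕ))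
    (hb : (b : ℕ) < mid₂) (hb' : (b' : ℕ) < mid₂) (hp : mid₂ ≤ (p : ℕ)) (hp' : mid₂ ≤ (p' : ℕ))
    (h1 : IsDominant d v ε θ (τ j y a b p u)) (h2 : IsDominant d v ε θ' (τ j' y' a' b' p' u')) (hθ : θ < θ')
    (hne : ¬ (j = j' ∧ y = y')) : s₁ j y < s₁ j' y' := by
  have hya : y < a := Fin.lt_def.2 (by omega)
  have hbp : b < p := Fin.lt_def.2 (by omega)
  have hya' : y' < a' := Fin.lt_def.2 (by omega)
  have hbp' : b' < p' := Fin.lt_def.2 (by omega)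
  have hy'a : y' < a := Fin.lt_def.2 (by omega)
  have hya'' : y < a' := Fin.lt_def.2 (by omega)
  have e1 := weight_lt d v ε τ s₁ s₂ s₃ A W B hinj hpres hw hya hbp hy'a hbp h1 (j' := j') (a' := a) (b' := b) (u' := u)
    (by rintro ⟨e1, e2, -, -, -, -⟩; exact hne ⟨e1, e2⟩)
  have e2 := weight_lt d v ε τ s₁ s₂ s₃ A W B hinj hpres hw hya' hbp' hya'' hbp' h2 (j' := j) (a' := a') (b' := b') (u' := u')
    (by rintro ⟨e1, e2, -, -, -, -⟩; exact hne ⟨e1.symm, e2.symm⟩)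
  nlinarith

include hinj hpres hw in
/-- MIDDLE register moves forward: `s₂ a b < s₂ a' b'` unless `(a, b) = (a', b')`. -/
theorem s2_lt_of_cc {j j' : Fin N} {y y' a a' : Fin L₁} {b b' p p' : Fin L₂} {u u' : Fin U} {θ θ' : ℤ} {mid₁ mid₂ : ℕ}
    (hy : (y : ℕ) < mid₁) (hy' : (y' : ℕ) < mid₁) (ha : mid₁ ≤ (a : ℕ)) (ha' : mid₁ ≤ (a' : ℕ))
    (hb : (b : ℕ) < mid₂) (hb' : (b' : ℕ) < mid₂) (hp : mid₂ ≤ (p : ℕ)) (hp' : mid₂ ≤ (p' : ℕ))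
    (h1 : IsDominant d v ε θ (τ j y a b p u)) (h2 : IsDominant d v ε θ' (τ j' y' a' b' p' u')) (hθ : θ < θ')
    (hne : ¬ (a = a' ∧ b = b')) : s₂ a b < s₂ a' b' := by
  have hya : y < a := Fin.lt_def.2 (by omega)
  have hbp : b < p := Fin.lt_def.2 (by omega)
  have hya' : y' < a' := Fin.lt_def.2 (by omega)
  have hbp' : b' < p' := Fin.lt_def.2 (by omega)
  -- the competitors `(j, y, a', b', p, u)` of the first member and `(j', y', a, b, p', u')` of the second
  have hya'' : y < a' := Fin.lt_def.2 (by omega)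
  have hb'p : b' < p := Fin.lt_def.2 (by omega)
  have hy'a : y' < a := Fin.lt_def.2 (by omega)
  have hbp'' : b < p' := Fin.lt_def.2 (by omega)
  have e1 := weight_lt d v ε τ s₁ s₂ s₃ A W B hinj hpres hw hya hbp hya'' hb'p h1 (j' := j) (a' := a') (b' := b') (u' := u)
    (by rintro ⟨-, -, e3, e4, -, -⟩; exact hne ⟨e3, e4⟩)
  have e2 := weight_lt d v ε τ s₁ s₂ s₃ A W B hinj hpres hw hya' hbp' hy'a hbp'' h2 (j' := j') (a' := a) (b' := b) (u' := u')
    (by rintro ⟨-, -, e3, e4, -, -⟩; exact hne ⟨e3.symm, e4.symm⟩)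
  nlinarith

include hinj hpres hw in
/-- THIRD register moves forward: `s₃ p u < s₃ p' u'` unless `(p, u) = (p', u')`. -/
theorem s3_lt_of_cc {j j' : Fin N} {y y' a a' : Fin L₁} {b b' p p' : Fin L₂} {u u' : Fin U} {θ θ' : ℤ} {mid₁ mid₂ : ℕ}
    (hy : (y : ℕ) < mid₁) (hy' : (y' : ℕ) < mid₁) (ha : mid₁ ≤ (a : ℕ)) (ha' : mid₁ ≤ (a' : ℕ))
    (hb : (b : ℕ) < mid₂) (hb' : (b' : ℕ) < mid₂) (hp : mid₂ ≤ (p : ℕ)) (hp' : mid₂ ≤ (p' : ℕ))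
    (h1 : IsDominant d v ε θ (τ j y a b p u)) (h2 : IsDominant d v ε θ' (τ j' y' a' b' p' u')) (hθ : θ < θ')
    (hne : ¬ (p = p' ∧ u = u')) : s₃ p u < s₃ p' u' := by
  have hya : y < a := Fin.lt_def.2 (by omega)
  have hbp : b < p := Fin.lt_def.2 (by omega)
  have hya' : y' < a' := Fin.lt_def.2 (by omega)
  have hbp' : b' < p' := Fin.lt_def.2 (by omega)
  have hbp'' : b < p' := Fin.lt_def.2 (by omega)
  have hb'p : b' < p := Fin.lt_def.2 (by omega)
  have e1 := weight_lt d v ε τ s₁ s₂ s₃ A W B hinj hpres hw hya hbp hya hbp'' h1 (j' := j) (a' := a) (b' := b) (u' := u')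
    (by rintro ⟨-, -, -, -, e5, e6⟩; exact hne ⟨e5, e6⟩)
  have e2 := weight_lt d v ε τ s₁ s₂ s₃ A W B hinj hpres hw hya' hbp' hya' hb'p h2 (j' := j') (a' := a') (b' := b') (u' := u)
    (by rintro ⟨-, -, -, -, e5, e6⟩; exact hne ⟨e5.symm, e6.symm⟩)
  nlinarith

include hinj hpres hw in
/-- CROSS–CROSS COUNT.  The members of the family that are dominant (each at some integer slope), whose first interval crosses
the cut `mid₁` of the window-1 range `[lo₁, hi₁)` (`lo₁ ≤ y < mid₁ ≤ a < hi₁`) and whose second interval crosses the cut `mid₂`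
of `[lo₂, hi₂)` (`lo₂ ≤ b < mid₂ ≤ p < hi₂`), number at most `N·(mid₁ − lo₁) + (hi₁ − mid₁)·(mid₂ − lo₂) + U·(hi₂ − mid₂)`:
along increasing slope each register advances through its finitely many points (strictly increasing own slope whenever it
moves), at least one register moving at each step — a monotone staircase in three rank statistics (`card_le_of_biMonotone`
with `f` = first-register rank and `g` = middle rank + third rank).  The triple direct sum: all three single-register swaps of two
such members are feasible. -/
theorem cc_card_le (lo₁ mid₁ hi₁ lo₂ mid₂ hi₂ : ℕ) (C : Finset ((Fin N × Fin L₁ × Fin L₁ × Fin L₂ × Fin L₂ × Fin U)))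
    (hC : ∀ i ∈ C, lo₁ ≤ (i.2.1 : ℕ) ∧ (i.2.1 : ℕ) < mid₁ ∧ mid₁ ≤ (i.2.2.1 : ℕ) ∧ (i.2.2.1 : ℕ) < hi₁ ∧
      lo₂ ≤ (i.2.2.2.1 : ℕ) ∧ (i.2.2.2.1 : ℕ) < mid₂ ∧ mid₂ ≤ (i.2.2.2.2.1 : ℕ) ∧ (i.2.2.2.2.1 : ℕ) < hi₂ ∧
      ∃ θ : ℤ, IsDominant d v ε θ (τ i.1 i.2.1 i.2.2.1 i.2.2.2.1 i.2.2.2.2.1 i.2.2.2.2.2)) :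
    C.card ≤ N * (mid₁ - lo₁) + (hi₁ - mid₁) * (mid₂ - lo₂) + U * (hi₂ - mid₂) := by
  classical
  rcases C.eq_empty_or_nonempty with hCe | hCne
  · simp [hCe]
  have hex : ∀ i ∈ C, ∃ θ : ℤ, IsDominant d v ε θ (τ i.1 i.2.1 i.2.2.1 i.2.2.2.1 i.2.2.2.2.1 i.2.2.2.2.2) :=
    fun i hi => (hC i hi).2.2.2.2.2.2.2.2
  choose! Θ hΘ using hex
  -- the three point ranges and rank statistics
  let P1 : Finset (Fin N × Fin L₁) := Finset.univ.filter (fun q => lo₁ ≤ (q.2 : ℕ) ∧ (q.2 : ℕ) < mid₁)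
  let P2 : Finset (Fin L₁ × Fin L₂) :=
    Finset.univ.filter (fun q => mid₁ ≤ (q.1 : ℕ) ∧ (q.1 : ℕ) < hi₁ ∧ lo₂ ≤ (q.2 : ℕ) ∧ (q.2 : ℕ) < mid₂)
  let P3 : Finset (Fin L₂ × Fin U) := Finset.univ.filter (fun q => mid₂ ≤ (q.1 : ℕ) ∧ (q.1 : ℕ) < hi₂)
  let f : (Fin N × Fin L₁ × Fin L₁ × Fin L₂ × Fin L₂ × Fin U) → ℕ := fun i => (P1.filter (fun q => s₁ i.1 i.2.1 < s₁ q.1 q.2)).card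
  let g₂ : (Fin N × Fin L₁ × Fin L₁ × Fin L₂ × Fin L₂ × Fin U) → ℕ := fun i => (P2.filter (fun q => s₂ q.1 q.2 < s₂ i.2.2.1 i.2.2.2.1)).card
  let g₃ : (Fin N × Fin L₁ × Fin L₁ × Fin L₂ × Fin L₂ × Fin U) → ℕ := fun i => (P3.filter (fun q => s₃ q.1 q.2 < s₃ i.2.2.2.2.1 i.2.2.2.2.2)).card
  let g : (Fin N × Fin L₁ × Fin L₁ × Fin L₂ × Fin L₂ × Fin U) → ℕ := fun i => g₂ i + g₃ i
  -- sizes of the point ranges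
  have hP1 : P1.card ≤ N * (mid₁ - lo₁) := by
    have h := Finset.card_le_card_of_injOn (s := P1)
      (t := (Finset.univ : Finset (Fin N)) ×ˢ Finset.Ico lo₁ mid₁) (fun q => (q.1, (q.2 : ℕ)))
      (fun q hq => by
        have hq' := (Finset.mem_filter.1 hq).2
        exact Finset.mem_coe.2 (by simp [hq']))
      (by
        intro x hx y hy hxy
        simp only [Prod.mk.injEq] at hxy
        exact Prod.ext hxy.1 (Fin.ext hxy.2))
    simpa [Finset.card_product] using h
  have hP2 : P2.card ≤ (hi₁ - mid₁) * (mid₂ - lo₂) := by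
    have h := Finset.card_le_card_of_injOn (s := P2)
      (t := Finset.Ico mid₁ hi₁ ×ˢ Finset.Ico lo₂ mid₂) (fun q => ((q.1 : ℕ), (q.2 : ℕ)))
      (fun q hq => by
        have hq' := (Finset.mem_filter.1 hq).2
        exact Finset.mem_coe.2 (by simp [hq']))
      (by
        intro x hx y hy hxy
        simp only [Prod.mk.injEq] at hxy
        exact Prod.ext (Fin.ext hxy.1) (Fin.ext hxy.2))
    simpa [Finset.card_product] using h
  have hP3 : P3.card ≤ U * (hi₂ - mid₂) := by
    have h := Finset.card_le_card_of_injOn (s := P3)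
      (t := Finset.Ico mid₂ hi₂ ×ˢ (Finset.univ : Finset (Fin U))) (fun q => ((q.1 : ℕ), q.2))
      (fun q hq => by
        have hq' := (Finset.mem_filter.1 hq).2
        exact Finset.mem_coe.2 (by simp [hq']))
      (by
        intro x hx y hy hxy
        simp only [Prod.mk.injEq] at hxy
        exact Prod.ext (Fin.ext hxy.1) hxy.2)
    simpa [Finset.card_product, Nat.mul_comm] using h
  -- own points are in range and not counted by the own rank
  have hfle : ∀ i ∈ C, f i + 1 ≤ N * (mid₁ - lo₁) := by
    intro i hi
    obtain ⟨h1, h2, -, -, -, -, -, -, -⟩ := hC i hi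
    have hmem : (i.1, i.2.1) ∈ P1 := by simp [P1, h1, h2]
    have hsub : P1.filter (fun q => s₁ i.1 i.2.1 < s₁ q.1 q.2) ⊆ P1.erase (i.1, i.2.1) := by
      intro q hq
      refine Finset.mem_erase.2 ⟨?_, (Finset.mem_filter.1 hq).1⟩
      rintro rfl; exact lt_irrefl _ (Finset.mem_filter.1 hq).2
    have := Finset.card_le_card hsub; rw [Finset.card_erase_of_mem hmem] at this
    have hpos : 0 < P1.card := Finset.card_pos.2 ⟨_, hmem⟩; simp only [f]; omega
  have hg₂le : ∀ i ∈ C, g₂ i + 1 ≤ (hi₁ - mid₁) * (mid₂ - lo₂) := by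
    intro i hi
    obtain ⟨-, -, h3, h4, h5, h6, -, -, -⟩ := hC i hi
    have hmem : (i.2.2.1, i.2.2.2.1) ∈ P2 := by simp [P2, h3, h4, h5, h6]
    have hsub : P2.filter (fun q => s₂ q.1 q.2 < s₂ i.2.2.1 i.2.2.2.1) ⊆ P2.erase (i.2.2.1, i.2.2.2.1) := by
      intro q hq
      refine Finset.mem_erase.2 ⟨?_, (Finset.mem_filter.1 hq).1⟩
      rintro rfl; exact lt_irrefl _ (Finset.mem_filter.1 hq).2
    have := Finset.card_le_card hsub; rw [Finset.card_erase_of_mem hmem] at this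
    have hpos : 0 < P2.card := Finset.card_pos.2 ⟨_, hmem⟩; simp only [g₂]; omega
  have hg₃le : ∀ i ∈ C, g₃ i + 1 ≤ U * (hi₂ - mid₂) := by
    intro i hi
    obtain ⟨-, -, -, -, -, -, h7, h8, -⟩ := hC i hi
    have hmem : (i.2.2.2.2.1, i.2.2.2.2.2) ∈ P3 := by simp [P3, h7, h8]
    have hsub : P3.filter (fun q => s₃ q.1 q.2 < s₃ i.2.2.2.2.1 i.2.2.2.2.2) ⊆ P3.erase (i.2.2.2.2.1, i.2.2.2.2.2) := by
      intro q hq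
      refine Finset.mem_erase.2 ⟨?_, (Finset.mem_filter.1 hq).1⟩
      rintro rfl; exact lt_irrefl _ (Finset.mem_filter.1 hq).2
    have := Finset.card_le_card hsub; rw [Finset.card_erase_of_mem hmem] at this
    have hpos : 0 < P3.card := Finset.card_pos.2 ⟨_, hmem⟩; simp only [g₃]; omega
  -- strict monotonicity of the ranks
  have hf_lt : ∀ x ∈ C, ∀ z ∈ C, s₁ x.1 x.2.1 < s₁ z.1 z.2.1 → f z < f x := by
    intro x hx z hz hxz
    obtain ⟨h1, h2, -, -, -, -, -, -, -⟩ := hC z hz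
    have hmem : (z.1, z.2.1) ∈ P1 := by simp [P1, h1, h2]
    apply Finset.card_lt_card
    refine ⟨fun q hq => ?_, fun hsub => ?_⟩
    · rw [Finset.mem_filter] at hq ⊢
      exact ⟨hq.1, lt_trans hxz hq.2⟩
    · have : (z.1, z.2.1) ∈ P1.filter (fun q => s₁ z.1 z.2.1 < s₁ q.1 q.2) :=
        hsub (Finset.mem_filter.2 ⟨hmem, hxz⟩)
      exact lt_irrefl _ (Finset.mem_filter.1 this).2
  have hg₂_lt : ∀ x ∈ C, ∀ z ∈ C, s₂ x.2.2.1 x.2.2.2.1 < s₂ z.2.2.1 z.2.2.2.1 → g₂ x < g₂ z := by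
    intro x hx z hz hxz
    obtain ⟨-, -, h3, h4, h5, h6, -, -, -⟩ := hC x hx
    have hmem : (x.2.2.1, x.2.2.2.1) ∈ P2 := by simp [P2, h3, h4, h5, h6]
    apply Finset.card_lt_card
    refine ⟨fun q hq => ?_, fun hsub => ?_⟩
    · rw [Finset.mem_filter] at hq ⊢
      exact ⟨hq.1, lt_trans hq.2 hxz⟩
    · have : (x.2.2.1, x.2.2.2.1) ∈ P2.filter (fun q => s₂ q.1 q.2 < s₂ x.2.2.1 x.2.2.2.1) :=
        hsub (Finset.mem_filter.2 ⟨hmem, hxz⟩)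
      exact lt_irrefl _ (Finset.mem_filter.1 this).2
  have hg₃_lt : ∀ x ∈ C, ∀ z ∈ C, s₃ x.2.2.2.2.1 x.2.2.2.2.2 < s₃ z.2.2.2.2.1 z.2.2.2.2.2 → g₃ x < g₃ z := by
    intro x hx z hz hxz
    obtain ⟨-, -, -, -, -, -, h7, h8, -⟩ := hC x hx
    have hmem : (x.2.2.2.2.1, x.2.2.2.2.2) ∈ P3 := by simp [P3, h7, h8]
    apply Finset.card_lt_card
    refine ⟨fun q hq => ?_, fun hsub => ?_⟩
    · rw [Finset.mem_filter] at hq ⊢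
      exact ⟨hq.1, lt_trans hq.2 hxz⟩
    · have : (x.2.2.2.2.1, x.2.2.2.2.2) ∈ P3.filter (fun q => s₃ q.1 q.2 < s₃ x.2.2.2.2.1 x.2.2.2.2.2) :=
        hsub (Finset.mem_filter.2 ⟨hmem, hxz⟩)
      exact lt_irrefl _ (Finset.mem_filter.1 this).2
  have hg₂_le : ∀ x ∈ C, ∀ z ∈ C, s₂ x.2.2.1 x.2.2.2.1 ≤ s₂ z.2.2.1 z.2.2.2.1 → g₂ x ≤ g₂ z := by
    intro x hx z hz hxz
    apply Finset.card_le_card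
    intro q hq
    rw [Finset.mem_filter] at hq ⊢
    exact ⟨hq.1, lt_of_lt_of_le hq.2 hxz⟩
  have hg₃_le : ∀ x ∈ C, ∀ z ∈ C, s₃ x.2.2.2.2.1 x.2.2.2.2.2 ≤ s₃ z.2.2.2.2.1 z.2.2.2.2.2 → g₃ x ≤ g₃ z := by
    intro x hx z hz hxz
    apply Finset.card_le_card
    intro q hq
    rw [Finset.mem_filter] at hq ⊢
    exact ⟨hq.1, lt_of_lt_of_le hq.2 hxz⟩
  have hf_le : ∀ x ∈ C, ∀ z ∈ C, s₁ x.1 x.2.1 ≤ s₁ z.1 z.2.1 → f z ≤ f x := by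
    intro x hx z hz hxz
    apply Finset.card_le_card
    intro q hq
    rw [Finset.mem_filter] at hq ⊢
    exact ⟨hq.1, lt_of_le_of_lt hxz hq.2⟩
  -- the one-directional chain step: every register slope weakly increases, at least one strictly
  have hstep : ∀ x ∈ C, ∀ z ∈ C, Θ x < Θ z → f z ≤ f x ∧ g x ≤ g z ∧ (f z < f x ∨ g x < g z) := by
    intro x hx z hz hxz
    obtain ⟨-, hyx, hax, -, -, hbx, hpx, -, -⟩ := hC x hx
    obtain ⟨-, hyz, haz, -, -, hbz, hpz, -, -⟩ := hC z hz
    have hdx := hΘ x hx; have hdz := hΘ z hz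
    -- weak monotonicity of each register slope (strict unless equal states)
    have m1 : s₁ x.1 x.2.1 ≤ s₁ z.1 z.2.1 := by
      by_cases h : x.1 = z.1 ∧ x.2.1 = z.2.1
      · rw [h.1, h.2]
      · exact le_of_lt (s1_lt_of_cc d v ε τ s₁ s₂ s₃ A W B hinj hpres hw hyx hyz hax haz hbx hbz hpx hpz hdx hdz hxz h)
    have m2 : s₂ x.2.2.1 x.2.2.2.1 ≤ s₂ z.2.2.1 z.2.2.2.1 := by
      by_cases h : x.2.2.1 = z.2.2.1 ∧ x.2.2.2.1 = z.2.2.2.1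
      · rw [h.1, h.2]
      · exact le_of_lt (s2_lt_of_cc d v ε τ s₁ s₂ s₃ A W B hinj hpres hw hyx hyz hax haz hbx hbz hpx hpz hdx hdz hxz h)
    have m3 : s₃ x.2.2.2.2.1 x.2.2.2.2.2 ≤ s₃ z.2.2.2.2.1 z.2.2.2.2.2 := by
      by_cases h : x.2.2.2.2.1 = z.2.2.2.2.1 ∧ x.2.2.2.2.2 = z.2.2.2.2.2
      · rw [h.1, h.2]
      · exact le_of_lt (s3_lt_of_cc d v ε τ s₁ s₂ s₃ A W B hinj hpres hw hyx hyz hax haz hbx hbz hpx hpz hdx hdz hxz h)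
    refine ⟨hf_le x hx z hz m1, Nat.add_le_add (hg₂_le x hx z hz m2) (hg₃_le x hx z hz m3), ?_⟩
    by_cases h1 : x.1 = z.1 ∧ x.2.1 = z.2.1
    · by_cases h2 : x.2.2.1 = z.2.2.1 ∧ x.2.2.2.1 = z.2.2.2.1
      · by_cases h3 : x.2.2.2.2.1 = z.2.2.2.2.1 ∧ x.2.2.2.2.2 = z.2.2.2.2.2
        · exfalso
          have hxz' : x = z := Prod.ext h1.1 (Prod.ext h1.2 (Prod.ext h2.1 (Prod.ext h2.2 (Prod.ext h3.1 h3.2))))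
          rw [hxz'] at hxz; exact lt_irrefl _ hxz
        · have hs := s3_lt_of_cc d v ε τ s₁ s₂ s₃ A W B hinj hpres hw hyx hyz hax haz hbx hbz hpx hpz hdx hdz hxz h3
          exact Or.inr (Nat.add_lt_add_of_le_of_lt (hg₂_le x hx z hz m2) (hg₃_lt x hx z hz hs))
      · have hs := s2_lt_of_cc d v ε τ s₁ s₂ s₃ A W B hinj hpres hw hyx hyz hax haz hbx hbz hpx hpz hdx hdz hxz h2
        exact Or.inr (Nat.add_lt_add_of_lt_of_le (hg₂_lt x hx z hz hs) (hg₃_le x hx z hz m3))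
    · have hs := s1_lt_of_cc d v ε τ s₁ s₂ s₃ A W B hinj hpres hw hyx hyz hax haz hbx hbz hpx hpz hdx hdz hxz h1
      exact Or.inl (hf_lt x hx z hz hs)
  have hch : ∀ x ∈ C, ∀ z ∈ C, x ≠ z →
      (f z ≤ f x ∧ g x ≤ g z ∧ (f z < f x ∨ g x < g z)) ∨
      (f x ≤ f z ∧ g z ≤ g x ∧ (f x < f z ∨ g z < g x)) := by
    intro x hx z hz hxz
    rcases lt_trichotomy (Θ x) (Θ z) with hlt | heq | hgt
    · exact Or.inl (hstep x hx z hz hlt)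
    · exfalso
      obtain ⟨-, hyx, hax, -, -, hbx, hpx, -, -⟩ := hC x hx
      obtain ⟨-, hyz, haz, -, -, hbz, hpz, -, -⟩ := hC z hz
      have hdx := hΘ x hx; have hdz := hΘ z hz
      rw [heq] at hdx
      obtain ⟨e1, e2, e3, e4, e5, e6⟩ := eq_of_theta_eq d v ε τ s₁ s₂ s₃ A W B hinj hpres hw
        (Fin.lt_def.2 (by omega)) (Fin.lt_def.2 (by omega)) (Fin.lt_def.2 (by omega)) (Fin.lt_def.2 (by omega)) hdx hdz
      exact hxz (Prod.ext e1 (Prod.ext e2 (Prod.ext e3 (Prod.ext e4 (Prod.ext e5 e6)))))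
    · exact Or.inr (hstep z hz x hx hgt)
  have hmain := card_le_of_biMonotone C hCne f g hch
  obtain ⟨i0, hi0⟩ := hCne
  have hsupf : C.sup' ⟨i0, hi0⟩ f + 1 ≤ N * (mid₁ - lo₁) := by
    obtain ⟨z, hz, hfz⟩ := Finset.exists_mem_eq_sup' ⟨i0, hi0⟩ f
    rw [hfz]; exact hfle z hz
  have hsupg : C.sup' ⟨i0, hi0⟩ g + 2 ≤ (hi₁ - mid₁) * (mid₂ - lo₂) + U * (hi₂ - mid₂) := by
    obtain ⟨z, hz, hgz⟩ := Finset.exists_mem_eq_sup' ⟨i0, hi0⟩ g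
    rw [hgz]
    have e2 := hg₂le z hz; have e3 := hg₃le z hz
    simp only [g]; omega
  have e1 := Nat.sub_le (C.sup' ⟨i0, hi0⟩ f) (C.inf' ⟨i0, hi0⟩ f)
  have e2 := Nat.sub_le (C.sup' ⟨i0, hi0⟩ g) (C.inf' ⟨i0, hi0⟩ g); omega

end Family

end Summit.ValiantsHypothesis.ValiantsHypothesis.Theorems.KPlusLogSqLaw.ComparabilityChain
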